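import Literature.MathematicalPhysics.QuantumFieldTheory.Balaban1983to89.T3AveragedTailProfile
import Literature.MathematicalPhysics.QuantumFieldTheory.Balaban1983to89.T3HistoryTailReduction
import Literature.MathematicalPhysics.QuantumFieldTheory.Balaban1983to89.T3ThresholdSmallness
import Literature.MathematicalPhysics.QuantumFieldTheory.Balaban1983to89.T3Thresholds
import Literature.MathematicalPhysics.QuantumFieldTheory.Balaban1983to89.T4PairDerivBridge
import HarnessLib

/-!
# Route `CovariantDischarge` (rev 1, «SeveritySandwich» repair) — the SANDWICH RE-COVER and its arithmetic (route-independent part of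
# the door `HistoryTailOfSandwichSplit`; ideator seat `ym-r3-idea-2` gen 13, LINE 24 on crux stmt-QuantumFields-19936 `UnitScaleTilt.HistoryTailL`)

This file imports NO route file (theses-cone hygiene); the door itself is `CovariantDischargeHistoryTailOfSandwichSplit`.

* §1 `compl_histGood_subset_sandwich` / `real_compl_histGood_le_sandwich` — the SEVERITY-MAXIMAL SANDWICH RE-COVER: for threshold
  ladders `θf k` (finer/level, monotone in `k` from `θf 0`) and `θc k ≥ θf (k+1)` (coarser) with a ceiling severity `k₀`
  (`2 < θf k₀ i`, `dist1 ≤ 2`), the complement of Bałaban's small-history event `histGood (θf 0) K n` is contained in «bare-bad at the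
  unit scale» ∪ ⋃_{j < K−n} ⋃_{k < k₀} ⋃_p «finer heights θf k-small ∧ constrained coarser heights `≥ j+1` θc k-small ∧ level `j+1`
  θf k-bad at `p`» — `k` := the maximal severity at which the field is outside `histGood (θf k) K n`, `j+1` := its finest bad height.
* §2 `sum_severity_le` — severities are summed WITHOUT counting them: pieces of mass `≤ B`, empty once `2^k θ₀ > 2` ⇒ `Σ_{k<k₀} ≤ 4B/θ₀`.
* §3 ladder arithmetic `θ_{2^k b₀} = 2^k θ_{b₀}` (`θBal_ladder`), `γL^{-i} ≤ θ_{b₀}(i)` (`coupling_sq_le_θBal`), a ceiling severity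
  (`exists_ceiling`).

WHAT THIS IS NOT: pure bookkeeping — no tail estimate, no statement about the Gibbs measures beyond a union bound; rung R3 is a RECORD
rung (`YM3TorusSU2`), not the Clay statement.

References: T. Bałaban, CMP 102 (1985) 255–275 [Balaban1985UV3] ((7) p.257 the profile `p(g) = b₀(1+log g⁻¹)^{p₀}`, (71) p.273);
T. Bałaban, CMP 122 (1989) 355–392 [Balaban1989LargeFieldII] (Thm 1 p.358: the inductive large-field bookkeeping imitated here).
-/

noncomputable section

open MeasureTheory Filter Topology
open Literature.MathematicalPhysics.QuantumFieldTheory.Balaban1983to89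
open Literature.MathematicalPhysics.QuantumFieldTheory.Balaban1983to89.Missing
open Literature.MathematicalPhysics.QuantumFieldTheory.Balaban1983to89.T4Continuum
open Literature.MathematicalPhysics.QuantumFieldTheory.Balaban1983to89.T3ContinuumYM3Torus
open Literature.MathematicalPhysics.QuantumFieldTheory.Balaban1983to89.T3UnitScaleTilt
open Literature.MathematicalPhysics.QuantumFieldTheory.Balaban1983to89.T3UnitLawDensityEML (ℰp measurableE_ℰp)
open Literature.MathematicalPhysics.QuantumFieldTheory.Balaban1983to89.T3HistoryTailReduction
open Literature.MathematicalPhysics.QuantumFieldTheory.Balaban1983to89.T3BareTailProfile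
open Literature.MathematicalPhysics.QuantumFieldTheory.Balaban1983to89.T3AveragedTailProfile

namespace Summit.QuantumFields.YangMills.Theorems

namespace SandwichDischargeDoor

/-! ## §1 The severity-maximal sandwich re-cover (pure combinatorics of thresholds) -/

section Cover

variable (F : T3Family) {G : Type*} [GaugeGroup G] [MeasurableSpace G] (ℰ : LoopAverage G)

omit [MeasurableSpace G] in
/-- A threshold above `2 ≥ dist1` makes every field small. -/
theorem plaqSmall_of_two_lt {P : Params} {j : ℕ} {δ : ℝ} (hdist : ∀ g : G, dist1 g ≤ 2) (h : 2 < δ)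
    (V : GaugeField P j G) : PlaqSmall δ V :=
  fun _ => (hdist _).trans_lt h

omit [MeasurableSpace G] in
/-- **SEVERITY-MAXIMAL SANDWICH RE-COVER.** Thresholds `θf k i` (severity `k`, distance `i` from the unit scale; the level and the finer
heights) and `θc k i` (the coarser constrained heights), with `θf 0 ≤ θf k`, `θf (k+1) ≤ θc k`, and a ceiling severity `k₀` whose thresholds
exceed `2 ≥ dist1`: a field outside `histGood (θf 0) K n` is either bare-bad at `θf 0 K`, or — with `k < k₀` the MAXIMAL severity at which it
is outside `histGood (θf k) K n` and `j + 1 ≥ 1` the finest `θf k`-bad constrained height — inside the sandwich event: finer heights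
`θf k`-small, ALL constrained heights `≥ j + 1` `θc k`-small (maximality), level `j + 1` `θf k`-bad at some plaquette. Exact; no window. -/
theorem compl_histGood_subset_sandwich (θf θc : ℕ → ℕ → ℝ) (K n k₀ : ℕ)
    (hmono0 : ∀ k i, θf 0 i ≤ θf k i) (hlink : ∀ k i, θf (k + 1) i ≤ θc k i)
    (hdist : ∀ g : G, dist1 g ≤ 2) (htop : ∀ i, i ≤ K → 2 < θf k₀ i) :
    (histGood F ℰ (θf 0) K n)ᶜ ⊆
      {U | ¬ PlaqSmall (θf 0 K) U} ∪
      ⋃ j ∈ Finset.range (K - n), ⋃ k ∈ Finset.range k₀, ⋃ p : Plaq (F.P K) (j + 1),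
        {U | (∀ i, i < j + 1 → PlaqSmall (θf k (K - i))
                (Averaging.iter (fun i' => BlockAveraging.blockAvg (P := F.P K) (j := i') ℰ) i U)) ∧
             (∀ j', j + 1 ≤ j' → j' + n ≤ K → PlaqSmall (θc k (K - j'))
                (Averaging.iter (fun i' => BlockAveraging.blockAvg (P := F.P K) (j := i') ℰ) j' U)) ∧
             θf k (K - (j + 1)) ≤ dist1 (GaugeField.plaqHol
                (Averaging.iter (fun i' => BlockAveraging.blockAvg (P := F.P K) (j := i') ℰ) (j + 1) U) p)} := by
  classical
  intro U hU
  -- severity: outside the small-history event at the `k`-th rung of the ladder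
  let Sev : ℕ → Prop := fun k => U ∉ histGood F ℰ (θf k) K n
  have hSev0 : Sev 0 := hU
  have hSevTop : ¬ Sev k₀ := by
    intro h
    apply h
    intro j hj
    exact plaqSmall_of_two_lt hdist (htop _ (Nat.sub_le K j)) _
  -- the maximal severity below the ceiling
  set k := Nat.findGreatest Sev k₀ with hk_def
  have hk : Sev k := Nat.findGreatest_spec (P := Sev) (Nat.zero_le k₀) hSev0
  have hk_le : k ≤ k₀ := Nat.findGreatest_le k₀
  have hk_lt : k < k₀ := lt_of_le_of_ne hk_le fun h => hSevTop (h ▸ hk)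
  have hk1 : ¬ Sev (k + 1) := Nat.findGreatest_is_greatest (Nat.lt_succ_self k) (Nat.succ_le_of_lt hk_lt)
  have hgood1 : U ∈ histGood F ℰ (θf (k + 1)) K n := not_not.mp hk1
  -- the finest bad constrained height at severity `k`
  have hex : ∃ j, j + n ≤ K ∧ ¬ PlaqSmall (θf k (K - j))
      (Averaging.iter (fun i' => BlockAveraging.blockAvg (P := F.P K) (j := i') ℰ) j U) := by
    by_contra hcon
    push Not at hcon
    exact hk hcon
  obtain ⟨j₀, hj₀n, hj₀bad, hfine⟩ : ∃ j₀, j₀ + n ≤ K ∧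
      ¬ PlaqSmall (θf k (K - j₀)) (Averaging.iter (fun i' => BlockAveraging.blockAvg (P := F.P K) (j := i') ℰ) j₀ U) ∧
      ∀ i, i < j₀ → PlaqSmall (θf k (K - i))
        (Averaging.iter (fun i' => BlockAveraging.blockAvg (P := F.P K) (j := i') ℰ) i U) := by
    refine ⟨Nat.find hex, (Nat.find_spec hex).1, (Nat.find_spec hex).2, fun i hi => ?_⟩
    by_contra hcon
    have := (Nat.find_spec hex).1
    exact Nat.find_min hex hi ⟨by omega, hcon⟩
  have hcoarse : ∀ j', j₀ ≤ j' → j' + n ≤ K → PlaqSmall (θc k (K - j'))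
      (Averaging.iter (fun i' => BlockAveraging.blockAvg (P := F.P K) (j := i') ℰ) j' U) :=
    fun j' _ hj'n p => (hgood1 j' hj'n p).trans_le (hlink k _)
  by_cases hj0 : j₀ = 0
  · -- bare: bad at severity `k` ⇒ bad at severity `0`
    subst hj0
    left
    intro hsmall
    exact hj₀bad (fun p => (hsmall p).trans_le (hmono0 k K))
  · right
    obtain ⟨p, hp⟩ : ∃ p, θf k (K - j₀) ≤ dist1 (GaugeField.plaqHol
        (Averaging.iter (fun i' => BlockAveraging.blockAvg (P := F.P K) (j := i') ℰ) j₀ U) p) := by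
      by_contra hcon
      push Not at hcon
      exact hj₀bad hcon
    obtain ⟨j, rfl⟩ : ∃ j, j₀ = j + 1 := ⟨j₀ - 1, by omega⟩
    simp only [Set.mem_iUnion, Finset.mem_range, Set.mem_setOf_eq, exists_prop]
    exact ⟨j, by omega, k, hk_lt, p, hfine, hcoarse, hp⟩

/-- The union bound over the re-cover, for a finite measure. -/
theorem real_compl_histGood_le_sandwich (θf θc : ℕ → ℕ → ℝ) (K n k₀ : ℕ)
    (hmono0 : ∀ k i, θf 0 i ≤ θf k i) (hlink : ∀ k i, θf (k + 1) i ≤ θc k i)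
    (hdist : ∀ g : G, dist1 g ≤ 2) (htop : ∀ i, i ≤ K → 2 < θf k₀ i)
    (μ : Measure (GaugeField (F.P K) 0 G)) [IsFiniteMeasure μ] :
    μ.real (histGood F ℰ (θf 0) K n)ᶜ ≤
      μ.real {U | ¬ PlaqSmall (θf 0 K) U} +
      ∑ j ∈ Finset.range (K - n), ∑ k ∈ Finset.range k₀, ∑ p : Plaq (F.P K) (j + 1),
        μ.real {U | (∀ i, i < j + 1 → PlaqSmall (θf k (K - i))
                (Averaging.iter (fun i' => BlockAveraging.blockAvg (P := F.P K) (j := i') ℰ) i U)) ∧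
             (∀ j', j + 1 ≤ j' → j' + n ≤ K → PlaqSmall (θc k (K - j'))
                (Averaging.iter (fun i' => BlockAveraging.blockAvg (P := F.P K) (j := i') ℰ) j' U)) ∧
             θf k (K - (j + 1)) ≤ dist1 (GaugeField.plaqHol
                (Averaging.iter (fun i' => BlockAveraging.blockAvg (P := F.P K) (j := i') ℰ) (j + 1) U) p)} := by
  refine (measureReal_mono (compl_histGood_subset_sandwich F ℰ θf θc K n k₀ hmono0 hlink hdist htop)
    (measure_ne_top _ _)).trans ((measureReal_union_le _ _).trans (add_le_add le_rfl ?_))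
  refine (measureReal_biUnion_finset_le _ _).trans (Finset.sum_le_sum fun j _ => ?_)
  refine (measureReal_biUnion_finset_le _ _).trans (Finset.sum_le_sum fun k _ => ?_)
  exact measureReal_iUnion_fintype_le _

end Cover

/-! ## §2 Counting severities without counting: the geometric trick -/

section Severity

variable {X : Type*} [MeasurableSpace X]

/-- If every piece has mass `≤ B`, and the `k`-th piece is EMPTY once `2^k·θ₀ > 2`, then the severities sum to `≤ 4B/θ₀`
(each term `≤ B·2/(2^k θ₀)`, a geometric series). -/
theorem sum_severity_le (μ : Measure X) [IsFiniteMeasure μ] (S : ℕ → Set X) {θ₀ B : ℝ} (hθ₀ : 0 < θ₀) (hB : 0 ≤ B)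
    (hSB : ∀ k, μ.real (S k) ≤ B) (hempty : ∀ k, 2 < 2 ^ k * θ₀ → S k = ∅) (k₀ : ℕ) :
    ∑ k ∈ Finset.range k₀, μ.real (S k) ≤ 4 * B / θ₀ := by
  have hterm : ∀ k, μ.real (S k) ≤ (2 * B / θ₀) * (1 / 2 : ℝ) ^ k := by
    intro k
    have h2k : (0 : ℝ) < 2 ^ k := pow_pos two_pos k
    have heq : (2 * B / θ₀) * (1 / 2 : ℝ) ^ k = B * (2 / (2 ^ k * θ₀)) := by
      rw [one_div_pow]; field_simp
    rw [heq]
    by_cases hk : 2 < 2 ^ k * θ₀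
    · rw [hempty k hk, measureReal_empty]; positivity
    · push Not at hk
      have h1 : 1 ≤ 2 / (2 ^ k * θ₀) := by
        rw [le_div_iff₀ (mul_pos h2k hθ₀)]; linarith
      calc μ.real (S k) ≤ B := hSB k
        _ = B * 1 := (mul_one B).symm
        _ ≤ B * (2 / (2 ^ k * θ₀)) := mul_le_mul_of_nonneg_left h1 hB
  calc ∑ k ∈ Finset.range k₀, μ.real (S k) ≤ ∑ k ∈ Finset.range k₀, (2 * B / θ₀) * (1 / 2 : ℝ) ^ k :=
        Finset.sum_le_sum fun k _ => hterm k
    _ = (2 * B / θ₀) * ∑ k ∈ Finset.range k₀, (1 / 2 : ℝ) ^ k := (Finset.mul_sum _ _ _).symm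
    _ ≤ (2 * B / θ₀) * 2 := mul_le_mul_of_nonneg_left (sum_geometric_two_le k₀) (by positivity)
    _ = 4 * B / θ₀ := by ring

end Severity

/-! ## §3 Threshold arithmetic on the ladder `b_k = 2^k b₀` -/

section Ladder

open Literature.MathematicalPhysics.QuantumFieldTheory.Balaban1983to89.T3Thresholds
open Literature.MathematicalPhysics.QuantumFieldTheory.Balaban1983to89.T3ThresholdSmallness

/-- `x_i = γL^{-i} ≤ θ_{b₀}(i)` for `b₀ ≥ 1`, `p₀ ≥ 0`, `0 < γ ≤ 1`, `L ≥ 1` (`θ = √x·p(√x)`, `p ≥ b₀ ≥ 1`, `x ≤ √x`). -/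
theorem coupling_sq_le_θBal {L : ℕ} (hL : 1 ≤ L) {γ b₀ p₀ : ℝ} (hγ : 0 < γ) (hγ1 : γ ≤ 1) (hb₀ : 1 ≤ b₀) (hp₀ : 0 ≤ p₀)
    (i : ℕ) : γ * ((L : ℝ)⁻¹) ^ i ≤ θBal L γ b₀ p₀ i := by
  rw [θBal_eq]
  set g := Real.sqrt (γ * ((L : ℝ)⁻¹) ^ i) with hg_def
  have hg0 : 0 < g := (sqrt_coupling_pos_le hL hγ i).1
  have hg1 : g ≤ 1 := coupling_le_one hL hγ hγ1 i
  have hx0 : 0 ≤ γ * ((L : ℝ)⁻¹) ^ i :=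
    mul_nonneg hγ.le (pow_nonneg (inv_nonneg.mpr (Nat.cast_nonneg L)) i)
  have hxg : γ * ((L : ℝ)⁻¹) ^ i = g * g := by
    rw [hg_def, Real.mul_self_sqrt hx0]
  have hp1 : 1 ≤ B10.pFun b₀ p₀ g := by
    unfold B10.pFun
    have hu := B10.log_inv_nonneg_of_le_one hg0 hg1
    have h1 : (1 : ℝ) ≤ (1 + Real.log g⁻¹) ^ p₀ := Real.one_le_rpow (by linarith) hp₀
    nlinarith
  rw [hxg]
  exact mul_le_mul_of_nonneg_left (hg1.trans hp1) hg0.le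

/-- Bałaban's thresholds are linear in the profile constant: `θ_{c·b₀}(i) = c·θ_{b₀}(i)` (as `OneStepWindowL.θBal_const_mul`,
re-proved so that this file imports no route). [cite: Balaban1985UV3, (7) p.257] -/
theorem θBal_const_mul' (L : ℕ) (γ c b₀ p₀ : ℝ) (i : ℕ) : θBal L γ (c * b₀) p₀ i = c * θBal L γ b₀ p₀ i := by
  rw [θBal_eq, θBal_eq]
  unfold B10.pFun
  ring

/-- The ladder thresholds: `θ_{2^k b₀}(i) = 2^k·θ_{b₀}(i)`. [cite: Balaban1985UV3, (7) p.257] -/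
theorem θBal_ladder (L : ℕ) (γ b₀ p₀ : ℝ) (k i : ℕ) :
    θBal L γ (2 ^ k * b₀) p₀ i = 2 ^ k * θBal L γ b₀ p₀ i :=
  θBal_const_mul' L γ (2 ^ k) b₀ p₀ i

/-- A ceiling severity: some `k₀` with `2 < θ_{2^{k₀} b₀}(i)` for all `i ≤ K`. -/
theorem exists_ceiling {L : ℕ} (hL : 1 ≤ L) {γ b₀ p₀ : ℝ} (hγ : 0 < γ) (hγ1 : γ ≤ 1) (hb₀ : 1 ≤ b₀) (hp₀ : 0 ≤ p₀)
    (K : ℕ) : ∃ k₀ : ℕ, ∀ i, i ≤ K → 2 < θBal L γ (2 ^ k₀ * b₀) p₀ i := by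
  have hx : 0 < γ * ((L : ℝ)⁻¹) ^ K := mul_pos hγ (pow_pos (inv_pos.mpr (by exact_mod_cast hL)) K)
  obtain ⟨k₀, hk₀⟩ := pow_unbounded_of_one_lt (2 / (γ * ((L : ℝ)⁻¹) ^ K)) (one_lt_two : (1 : ℝ) < 2)
  refine ⟨k₀, fun i hi => ?_⟩
  rw [θBal_ladder]
  have hxi : γ * ((L : ℝ)⁻¹) ^ K ≤ γ * ((L : ℝ)⁻¹) ^ i :=
    mul_le_mul_of_nonneg_left (pow_le_pow_of_le_one (inv_nonneg.mpr (Nat.cast_nonneg L))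
      (inv_le_one_of_one_le₀ (by exact_mod_cast hL)) hi) hγ.le
  have hθ : γ * ((L : ℝ)⁻¹) ^ K ≤ θBal L γ b₀ p₀ i := hxi.trans (coupling_sq_le_θBal hL hγ hγ1 hb₀ hp₀ i)
  have h2 : 2 < 2 ^ k₀ * (γ * ((L : ℝ)⁻¹) ^ K) := by
    rwa [div_lt_iff₀ hx] at hk₀
  exact h2.trans_le (mul_le_mul_of_nonneg_left hθ (pow_pos two_pos k₀).le)

end Ladder



end SandwichDischargeDoor

end Summit.QuantumFields.YangMills.Theorems

end
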